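import Mathlib
import HarnessLib
import Literature.Probability.Percolation.BlockResampling
import Literature.Probability.Percolation.RussoFormula
import Literature.Probability.Percolation.BernoulliPercolation
import Literature.Probability.Percolation.PercolationEvents

/-!
# Noise expansion over a finite window, I: mask weights, expansion over the mask, pivotality helpers
# (infrastructure for `stub_noiseWindow`, line `noise_bridges`, crux `TetrahedronHarrisGap`, stmt-CriticalPhenomena-7799)

Lead prover-line-stmt-CriticalPhenomena-7799-c3-0.  For Bernoulli bond percolation `P = P_p` on a countable graph `G`, a finite
WINDOW `W ⊆ E(G)`, an independent MASK `M ∼ P_t` and an independent copy `ω'`, the NOISED configuration is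
`ω_t = resample (M ∩ W) (ω, ω')`.  General facts of every product measure:

* `real_setOf_obs_eq_prod` — the mask weights `P_t{obs M W = S} = ∏_{i ∈ W} (S ∋ i ? t : 1 − t)` (`S ⊆ W ⊆ E(G)`);
* `measureReal_triple_setOf_obs` (registered) — EXPANSION OVER THE MASK: for events read through `obs M W`,
  `(P ⊗ P ⊗ P_t){x | (x.1, x.2.1) ∈ D (obs x.2.2 W)} = Σ_{S ⊆ W} P_t{obs = S} · (P ⊗ P)(D S)` (disjoint union + `prodAssoc`);
* `isPivotal_resample_insert_iff` — XOR-pivotality AT `f` of the resampled configuration does not read whether `f` is resampled;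
  `measurableSet_setOf_isPivotal'` — pivotality events of measurable (not necessarily monotone) events are measurable.
Companion: `…StubNoiseWindowOneBit.lean` (two-bit expansion, one-bit covariance), `…StubNoiseWindow.lean` (the window formula).
-/

noncomputable section

namespace Summit.CriticalPhenomena.PercolationContinuityZ3.Theorems.TetrahedronHarrisGap

open MeasureTheory
open Literature.Probability.Percolation Literature.Probability.LatticeModels

variable {V : Type*}

/-! ### Mask weights -/

/-- `{M | obs M W = S}` is the `W`-cylinder at `S` (for `S ⊆ W`). -/
theorem setOf_obs_eq_eq_localCylinder {W S : Finset (Sym2 V)} (hS : S ⊆ W) :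
    {M : BondConfig V | obs M W = S} = localCylinder (↑W : Set (Sym2 V)) ↑S := by
  ext M
  simp only [Set.mem_setOf_eq, localCylinder, Finset.mem_coe]
  constructor
  · intro h i hi
    rw [← h, mem_obs_iff]
    exact ⟨fun hM => ⟨hi, hM⟩, fun h' => h'.2⟩
  · intro h
    ext i
    rw [mem_obs_iff]
    exact ⟨fun ⟨hi, hM⟩ => (h i hi).1 hM, fun hiS => ⟨hS hiS, (h i (hS hiS)).2 hiS⟩⟩

open Classical in
/-- **Mask weights**: for `S ⊆ W ⊆ E(G)`, `P_t{obs M W = S} = ∏_{i ∈ W} (if i ∈ S then t else 1 − t)`. -/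
theorem real_setOf_obs_eq_prod (G : SimpleGraph V) (t : unitInterval) {W S : Finset (Sym2 V)}
    (hW : (↑W : Set (Sym2 V)) ⊆ G.edgeSet) (hS : S ⊆ W) :
    (bondPercolation G t).real {M : BondConfig V | obs M W = S} =
      ∏ i ∈ W, (if i ∈ S then (t : ℝ) else 1 - (t : ℝ)) := by
  rw [setOf_obs_eq_eq_localCylinder hS]
  unfold bondPercolation
  rw [Russo.setBernoulli_real_localCylinder G.edgeSet t W ↑S]
  refine Finset.prod_congr rfl fun i hi => ?_
  have hiE : i ∈ G.edgeSet := hW (Finset.mem_coe.2 hi)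
  simp only [Russo.weight, Finset.mem_coe, hiE, if_true]

/-! ### Expansion over the mask -/

/-- The mask events `{x | obs x.2.2 W = S}` are measurable in the triple product. -/
theorem measurableSet_setOf_obs_snd_snd (W S : Finset (Sym2 V)) :
    MeasurableSet {x : BondConfig V × (BondConfig V × BondConfig V) | obs x.2.2 W = S} :=
  (measurableSet_setOf_obs W (· = S)).preimage (measurable_snd.comp measurable_snd)

/-- **Expansion over the mask.**  For a family of measurable two-replica events `D S` indexed by the window pattern,
`(P ⊗ (P ⊗ P_t)){x | (x.1, x.2.1) ∈ D (obs x.2.2 W)} = Σ_{S ⊆ W} P_t{obs M W = S} · (P ⊗ P)(D S)`: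
split along the (finitely many, disjoint) values of `obs M W` and factor each piece through `prodAssoc`. -/
theorem measureReal_triple_setOf_obs {V : Type*} [Countable V] (G : SimpleGraph V) (p t : unitInterval) (W : Finset (Sym2 V))
    (D : Finset (Sym2 V) → Set (BondConfig V × BondConfig V)) (hD : ∀ S, MeasurableSet (D S)) :
    ((bondPercolation G p).prod ((bondPercolation G p).prod (bondPercolation G t))).real
        {x : BondConfig V × (BondConfig V × BondConfig V) | (x.1, x.2.1) ∈ D (obs x.2.2 W)} =
      ∑ S ∈ W.powerset, (bondPercolation G t).real {M : BondConfig V | obs M W = S} *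
        ((bondPercolation G p).prod (bondPercolation G p)).real (D S) := by
  classical
  set P := bondPercolation G p with hP
  set Pt := bondPercolation G t with hPt
  -- the event as a finite disjoint union over the mask pattern
  have hpair : Measurable fun x : BondConfig V × (BondConfig V × BondConfig V) => (x.1, x.2.1) :=
    measurable_fst.prodMk (measurable_fst.comp measurable_snd)
  have hsplit : {x : BondConfig V × (BondConfig V × BondConfig V) | (x.1, x.2.1) ∈ D (obs x.2.2 W)} =
      ⋃ S ∈ W.powerset, ((fun x : BondConfig V × (BondConfig V × BondConfig V) => (x.1, x.2.1)) ⁻¹' D S ∩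
        {x | obs x.2.2 W = S}) := by
    ext x
    simp only [Set.mem_setOf_eq, Set.mem_iUnion, Set.mem_inter_iff, Set.mem_preimage, exists_prop]
    constructor
    · intro hx
      exact ⟨obs x.2.2 W, Finset.mem_powerset.2 (obs_subset _ _), hx, rfl⟩
    · rintro ⟨S, -, hx, hS⟩
      rw [hS]
      exact hx
  rw [hsplit, measureReal_biUnion_finset]
  · refine Finset.sum_congr rfl fun S _ => ?_
    -- factor through `prodAssoc`
    have hmp := MeasureTheory.measurePreserving_prodAssoc P P Pt
    have hmeas : MeasurableSet ((fun x : BondConfig V × (BondConfig V × BondConfig V) => (x.1, x.2.1)) ⁻¹' D S ∩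
        {x | obs x.2.2 W = S}) := (hpair (hD S)).inter (measurableSet_setOf_obs_snd_snd W S)
    have hpre : (MeasurableEquiv.prodAssoc : (BondConfig V × BondConfig V) × BondConfig V ≃ᵐ
          BondConfig V × (BondConfig V × BondConfig V)) ⁻¹'
        ((fun x : BondConfig V × (BondConfig V × BondConfig V) => (x.1, x.2.1)) ⁻¹' D S ∩ {x | obs x.2.2 W = S}) =
        D S ×ˢ {M : BondConfig V | obs M W = S} := by
      ext y
      rcases y with ⟨⟨a, b⟩, M⟩
      simp [MeasurableEquiv.prodAssoc, Set.mem_prod]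
    have key := hmp.measure_preimage hmeas.nullMeasurableSet
    rw [hpre, Measure.prod_prod] at key
    rw [measureReal_def, ← key, ENNReal.toReal_mul, mul_comm]
    rfl
  · intro S _ T _ hST
    refine Set.disjoint_left.2 fun x hxS hxT => hST ?_
    exact hxS.2.symm.trans hxT.2
  · intro S _
    exact (hpair (hD S)).inter (measurableSet_setOf_obs_snd_snd W S)


/-! ### Pivotality under one-edge modifications -/

/-- For an increasing event, XOR-pivotality of `f` at `ω` reads: `insert f ω ∈ A` and `ω ∖ {f} ∉ A`. -/
theorem isPivotal_iff_of_isUpperSet {A : Set (BondConfig V)} (hA : IsUpperSet A) (f : Sym2 V) (ω : BondConfig V) :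
    IsPivotal A f ω ↔ insert f ω ∈ A ∧ ω \ {f} ∉ A := by
  unfold IsPivotal
  rw [xor_def]
  constructor
  · rintro (⟨h1, h2⟩ | ⟨h1, h2⟩)
    · exact ⟨h1, h2⟩
    · exact absurd (hA (Set.sdiff_subset.trans (Set.subset_insert f ω)) h1) h2
  · rintro ⟨h1, h2⟩
    exact Or.inl ⟨h1, h2⟩

/-- Two configurations agreeing off `f` have the same `insert f` and the same `· ∖ {f}`. -/
theorem insert_eq_and_sdiff_eq_of_agree {f : Sym2 V} {ξ ξ' : BondConfig V} (h : ∀ e, e ≠ f → (e ∈ ξ ↔ e ∈ ξ')) :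
    insert f ξ = insert f ξ' ∧ ξ \ {f} = ξ' \ {f} := by
  constructor
  · ext e
    by_cases he : e = f
    · subst he; simp
    · simp [Set.mem_insert_iff, he, h e he]
  · ext e
    by_cases he : e = f
    · subst he; simp
    · simp [he, h e he]

/-- Pivotality of `f` does not read the state of `f`: configurations agreeing off `f` have the same pivotality. -/
theorem isPivotal_congr_of_agree (A : Set (BondConfig V)) {f : Sym2 V} {ξ ξ' : BondConfig V}
    (h : ∀ e, e ≠ f → (e ∈ ξ ↔ e ∈ ξ')) : IsPivotal A f ξ ↔ IsPivotal A f ξ' := by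
  obtain ⟨h1, h2⟩ := insert_eq_and_sdiff_eq_of_agree h
  unfold IsPivotal
  rw [h1, h2]

/-- **Pivotality at `f` of the resampled configuration does not depend on whether `f` is resampled.** -/
theorem isPivotal_resample_insert_iff [DecidableEq V] (B : Set (BondConfig V)) (T : Finset (Sym2 V)) (f : Sym2 V)
    (y : BondConfig V × BondConfig V) :
    IsPivotal B f (resample (↑(insert f T) : Set (Sym2 V)) y) ↔ IsPivotal B f (resample (↑T : Set (Sym2 V)) y) := by
  refine isPivotal_congr_of_agree B fun e he => ?_
  rw [mem_resample_iff, mem_resample_iff]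
  simp [Finset.coe_insert, Set.mem_insert_iff, he]

/-- The map `ξ ↦ insert f ξ` is measurable. -/
theorem measurable_insert_edge (f : Sym2 V) : Measurable fun ξ : BondConfig V => insert f ξ :=
  measurable_set_iff.2 fun e => by
    simp only [Set.mem_insert_iff]
    exact measurable_const.or (measurable_set_mem e)

/-- The map `ξ ↦ ξ ∖ {f}` is measurable. -/
theorem measurable_sdiff_edge (f : Sym2 V) : Measurable fun ξ : BondConfig V => ξ \ {f} :=
  measurable_set_iff.2 fun e => by
    simp only [Set.mem_sdiff, Set.mem_singleton_iff]
    exact (measurable_set_mem e).and measurable_const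

/-- For a measurable event, the pivotality event `{ξ | IsPivotal A f ξ}` is measurable (no monotonicity needed). -/
theorem measurableSet_setOf_isPivotal' {A : Set (BondConfig V)} (hA : MeasurableSet A) (f : Sym2 V) :
    MeasurableSet {ξ : BondConfig V | IsPivotal A f ξ} := by
  have h1 : MeasurableSet {ξ : BondConfig V | insert f ξ ∈ A} := measurable_insert_edge f hA
  have h2 : MeasurableSet {ξ : BondConfig V | ξ \ {f} ∈ A} := measurable_sdiff_edge f hA
  have : {ξ : BondConfig V | IsPivotal A f ξ} =
      ({ξ | insert f ξ ∈ A} ∩ {ξ | ξ \ {f} ∈ A}ᶜ) ∪ ({ξ | ξ \ {f} ∈ A} ∩ {ξ | insert f ξ ∈ A}ᶜ) := by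
    ext ξ
    simp only [Set.mem_setOf_eq, IsPivotal, xor_def, Set.mem_union, Set.mem_inter_iff, Set.mem_compl_iff]
  rw [this]
  exact (h1.inter h2.compl).union (h2.inter h1.compl)

end Summit.CriticalPhenomena.PercolationContinuityZ3.Theorems.TetrahedronHarrisGap

end
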